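import Summits.AtomisticToContinuum.Crystallization.Theorems.SpectralChargeLedgerSummedShellPricingCalibrationLedger
import Summits.AtomisticToContinuum.Crystallization.Theorems.HullExactificationCascadeHcpLandscapeGapStubBoxMinimiserRigid
import Summits.AtomisticToContinuum.Crystallization.Theorems.SpectralChargeLedgerSummedShellPricingSpoiledByGross

/-!
# K1 `SpectralChargeLedger.SummedShellPricing` (stmt-AtomisticToContinuum-17044), line `Sketch`, skeleton v3:
# the CALIBRATION REDUCTION, part 2/2 — from the interior ledger to K1 modulo the hub crux (lead c1, 2026-08-17)

K1 follows from the hub crux `PhononSlackCertificates.CoerciveTwoShellGap` (stmt-13956) and ONE pointwise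
statement, the **calibrated site inequality at the box minimiser** (CSI, the registered residual stub
`stub_calibratedSiteInequality` of `Cruxes/SummedShellPricing/Lines/Sketch.lean`):

* `interiorLedgerAt_of_calibration` — CSI ∧ torus divergence ∧ calibrated floor ⇒ the interior relative ledger
  at every box minimiser `(a, h)` of `e(hcp ·,·)` (open box `9/10 < a < 1`, `|h − a√(2/3)| ≤ a/100`): summing
  the calibrated site energies `½Σ'V_LJ + Σ'g` over the motif of a periodic `P` gives `#motif·e(P)` EXACTLY
  (the divergence of the antisymmetric lattice-covariant flux vanishes on the torus,
  `SummedShellPricingTorusDivergence.stub_torusDivergence`, p172565), deep-good sites contribute `≥ e(hcp a h)`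
  (`+ κ` if τ-bad), every other motif site `≥ −C₀` (`SummedShellPricingCalibratedFloor.stub_calibratedFloor`,
  p172604);
* `interiorLedgerAt_of_calibratedSiteInequality` — the same with the two landed stubs discharged;
* `hcpRelativeLedger_of_interiorLedgerAt` — at the LANDED box minimiser (`HcpLandscapeGapBirth.stub_boxMinimiser`,
  enclosure `stub_boxMinimiserRigid` ⇒ K1's box `47/50 ≤ a ≤ 1`) and with the packing lemma
  `SummedShellPricingSpoiledByGross.stub_spoiledByGross` (p172384: motif sites within `R` of a two-shell-bad point
  are `≤ K`× the two-shell-bad motif sites), the interior ledger gives the e⋆-free relative ledger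
  `HcpRelativeLedger` (`c' = min c 1`, `C' = (C+1)K`);
* `summedShellPricing_of_coerciveTwoShellGap_of_calibratedSiteInequality` — with the landed split glue
  `SummedShellPricingSplit.SummedShellPricing_of_subs` (p169653: hub crux ∧ relative ledger ⇒ K1, through
  `e⋆ ≤ e(hcp)`, the torus glue p166291, the hub torus form p101526, periodisation p166315 and separation
  reduction p166632): **`CoerciveTwoShellGap → CSI → SummedShellPricing`**.

This file (part 2) holds the last two theorems; part 1 (`…CalibrationLedger.lean`) the first two.
All statements are written in the tree's vocabulary with the τ-goodness disjunction of K1 unfolded (no new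
definition).  CSI is the crux-sized residual (discrete null Lagrangian / atomistic stress at the zero-pressure
cell; cf. `Cruxes/HcpLandscapeGap/Lines/calibration.md`, whose stub ZA is its globally-templated special case).
-/

noncomputable section

namespace Summit.AtomisticToContinuum.Crystallization.Theorems.SummedShellPricingCalibration

open scoped BigOperators Classical
open Literature.MathematicalPhysics.StatisticalMechanics Literature.Geometry.DiscreteGeometry
open Summit.AtomisticToContinuum.Crystallization.Theorems

/-- Interior ledger (∃-cell form) ∧ packing ⇒ the e⋆-free relative ledger `HcpRelativeLedger` (unfolded): a mild
site is either `R`-interior (priced) or within `R` of a gross point (counted by the packing lemma); `c' = min c 1`,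
`C' = (C + 1)·K`. [folklore] -/
theorem hcpRelativeLedger_of_interiorLedger_of_packing
    (h₁ : ∃ (a₀ h₀ : ℝ) (ha : a₀ ≠ 0) (hh : h₀ ≠ 0), 47 / 50 ≤ a₀ ∧ a₀ ≤ 1 ∧ |h₀ - a₀ * Real.sqrt (2 / 3)| ≤ a₀ / 100 ∧
      ∃ R : ℝ, 0 < R ∧ ∃ C : ℝ, 0 ≤ C ∧ ∀ τ : ℝ, 0 < τ → τ ≤ 1 → ∃ c : ℝ, 0 < c ∧
        ∀ P : PeriodicConfiguration 3, (∀ u ∈ P.points, ∀ v ∈ P.points, u ≠ v → (1 / 3 : ℝ) ≤ dist u v) →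
          c * ((P.motif.filter fun q => ¬ (∃ A : EuclideanSpace ℝ (Fin 3) →ₗᵢ[ℝ] EuclideanSpace ℝ (Fin 3),
                   (∃ e : ↥{z : EuclideanSpace ℝ (Fin 3) | z ∈ P.points ∧ z ≠ q ∧ dist z (q) < 13 / 10 * a₀} ≃
                       ↥{p : EuclideanSpace ℝ (Fin 3) | p ∈ hcpStacking a₀ h₀ ∧ p ≠ 0 ∧ ‖p‖ < 13 / 10 * a₀},
                     ∀ t : ↥{z : EuclideanSpace ℝ (Fin 3) | z ∈ P.points ∧ z ≠ q ∧ dist z (q) < 13 / 10 * a₀},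
                       dist ((t : EuclideanSpace ℝ (Fin 3)) - q)
                         (A ((e t : ↥{p : EuclideanSpace ℝ (Fin 3) | p ∈ hcpStacking a₀ h₀ ∧ p ≠ 0 ∧ ‖p‖ < 13 / 10 * a₀}) : EuclideanSpace ℝ (Fin 3))) ≤ τ) ∨
                   (∃ e : ↥{z : EuclideanSpace ℝ (Fin 3) | z ∈ P.points ∧ z ≠ q ∧ dist z (q) < 13 / 10 * a₀} ≃
                       ↥{p : EuclideanSpace ℝ (Fin 3) | p ∈ fccStacking a₀ h₀ ∧ p ≠ 0 ∧ ‖p‖ < 13 / 10 * a₀},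
                     ∀ t : ↥{z : EuclideanSpace ℝ (Fin 3) | z ∈ P.points ∧ z ≠ q ∧ dist z (q) < 13 / 10 * a₀},
                       dist ((t : EuclideanSpace ℝ (Fin 3)) - q)
                         (A ((e t : ↥{p : EuclideanSpace ℝ (Fin 3) | p ∈ fccStacking a₀ h₀ ∧ p ≠ 0 ∧ ‖p‖ < 13 / 10 * a₀}) : EuclideanSpace ℝ (Fin 3))) ≤ τ)) ∧
                ∀ p ∈ P.points, dist p q ≤ R → IsTwoShellGoodSet (1 / 20) (47 / 50) 1 P.points p).card : ℝ)
            - C * ((P.motif.filter fun q =>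
                ∃ p ∈ P.points, dist p q ≤ R ∧ ¬ IsTwoShellGoodSet (1 / 20) (47 / 50) 1 P.points p).card : ℝ)
          ≤ (P.motif.card : ℝ) *
              (P.energyPerParticle lennardJones - (hcpPeriodicConfiguration ha hh).energyPerParticle lennardJones))
    (h₂ : ∀ R : ℝ, 0 < R → ∃ K : ℝ, 0 ≤ K ∧
      ∀ P : PeriodicConfiguration 3, (∀ u ∈ P.points, ∀ v ∈ P.points, u ≠ v → (1 / 3 : ℝ) ≤ dist u v) →
        ((P.motif.filter fun q =>
            ∃ p ∈ P.points, dist p q ≤ R ∧ ¬ IsTwoShellGoodSet (1 / 20) (47 / 50) 1 P.points p).card : ℝ)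
          ≤ K * ((P.motif.filter fun q => ¬ IsTwoShellGoodSet (1 / 20) (47 / 50) 1 P.points q).card : ℝ)) :
    (∃ (a₀ h₀ : ℝ) (ha : a₀ ≠ 0) (hh : h₀ ≠ 0), 47 / 50 ≤ a₀ ∧ a₀ ≤ 1 ∧ |h₀ - a₀ * Real.sqrt (2 / 3)| ≤ a₀ / 100 ∧
    ∃ C : ℝ, 0 ≤ C ∧ ∀ τ : ℝ, 0 < τ → τ ≤ 1 → ∃ c : ℝ, 0 < c ∧
      ∀ P : PeriodicConfiguration 3, (∀ u ∈ P.points, ∀ v ∈ P.points, u ≠ v → (1 / 3 : ℝ) ≤ dist u v) →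
        c * ((P.motif.filter fun q => ¬ (∃ A : EuclideanSpace ℝ (Fin 3) →ₗᵢ[ℝ] EuclideanSpace ℝ (Fin 3),
                   (∃ e : ↥{z : EuclideanSpace ℝ (Fin 3) | z ∈ P.points ∧ z ≠ q ∧ dist z (q) < 13 / 10 * a₀} ≃
                       ↥{p : EuclideanSpace ℝ (Fin 3) | p ∈ hcpStacking a₀ h₀ ∧ p ≠ 0 ∧ ‖p‖ < 13 / 10 * a₀},
                     ∀ t : ↥{z : EuclideanSpace ℝ (Fin 3) | z ∈ P.points ∧ z ≠ q ∧ dist z (q) < 13 / 10 * a₀},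
                       dist ((t : EuclideanSpace ℝ (Fin 3)) - q)
                         (A ((e t : ↥{p : EuclideanSpace ℝ (Fin 3) | p ∈ hcpStacking a₀ h₀ ∧ p ≠ 0 ∧ ‖p‖ < 13 / 10 * a₀}) : EuclideanSpace ℝ (Fin 3))) ≤ τ) ∨
                   (∃ e : ↥{z : EuclideanSpace ℝ (Fin 3) | z ∈ P.points ∧ z ≠ q ∧ dist z (q) < 13 / 10 * a₀} ≃
                       ↥{p : EuclideanSpace ℝ (Fin 3) | p ∈ fccStacking a₀ h₀ ∧ p ≠ 0 ∧ ‖p‖ < 13 / 10 * a₀},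
                     ∀ t : ↥{z : EuclideanSpace ℝ (Fin 3) | z ∈ P.points ∧ z ≠ q ∧ dist z (q) < 13 / 10 * a₀},
                       dist ((t : EuclideanSpace ℝ (Fin 3)) - q)
                         (A ((e t : ↥{p : EuclideanSpace ℝ (Fin 3) | p ∈ fccStacking a₀ h₀ ∧ p ≠ 0 ∧ ‖p‖ < 13 / 10 * a₀}) : EuclideanSpace ℝ (Fin 3))) ≤ τ)) ∧
              IsTwoShellGoodSet (1 / 20) (47 / 50) 1 P.points q).card : ℝ)
          - C * ((P.motif.filter fun q => ¬ IsTwoShellGoodSet (1 / 20) (47 / 50) 1 P.points q).card : ℝ)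
        ≤ (P.motif.card : ℝ) *
            (P.energyPerParticle lennardJones - (hcpPeriodicConfiguration ha hh).energyPerParticle lennardJones)) := by
  obtain ⟨a₀, h₀, ha, hh, hb1, hb2, hb3, R, hR, C, hC, hτ⟩ := h₁
  obtain ⟨K, hK, hpack⟩ := h₂ R hR
  refine ⟨a₀, h₀, ha, hh, hb1, hb2, hb3, (C + 1) * K, by positivity, ?_⟩
  intro τ hτ0 hτ1
  obtain ⟨c, hc, hP⟩ := hτ τ hτ0 hτ1
  refine ⟨min c 1, lt_min hc one_pos, ?_⟩
  intro P hsep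
  have hL := hP P hsep
  have hSK := hpack P hsep
  -- names for the four finsets
  set IB := (P.motif.filter fun q => ¬ (∃ A : EuclideanSpace ℝ (Fin 3) →ₗᵢ[ℝ] EuclideanSpace ℝ (Fin 3),
                   (∃ e : ↥{z : EuclideanSpace ℝ (Fin 3) | z ∈ P.points ∧ z ≠ q ∧ dist z (q) < 13 / 10 * a₀} ≃
                       ↥{p : EuclideanSpace ℝ (Fin 3) | p ∈ hcpStacking a₀ h₀ ∧ p ≠ 0 ∧ ‖p‖ < 13 / 10 * a₀},
                     ∀ t : ↥{z : EuclideanSpace ℝ (Fin 3) | z ∈ P.points ∧ z ≠ q ∧ dist z (q) < 13 / 10 * a₀},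
                       dist ((t : EuclideanSpace ℝ (Fin 3)) - q)
                         (A ((e t : ↥{p : EuclideanSpace ℝ (Fin 3) | p ∈ hcpStacking a₀ h₀ ∧ p ≠ 0 ∧ ‖p‖ < 13 / 10 * a₀}) : EuclideanSpace ℝ (Fin 3))) ≤ τ) ∨
                   (∃ e : ↥{z : EuclideanSpace ℝ (Fin 3) | z ∈ P.points ∧ z ≠ q ∧ dist z (q) < 13 / 10 * a₀} ≃
                       ↥{p : EuclideanSpace ℝ (Fin 3) | p ∈ fccStacking a₀ h₀ ∧ p ≠ 0 ∧ ‖p‖ < 13 / 10 * a₀},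
                     ∀ t : ↥{z : EuclideanSpace ℝ (Fin 3) | z ∈ P.points ∧ z ≠ q ∧ dist z (q) < 13 / 10 * a₀},
                       dist ((t : EuclideanSpace ℝ (Fin 3)) - q)
                         (A ((e t : ↥{p : EuclideanSpace ℝ (Fin 3) | p ∈ fccStacking a₀ h₀ ∧ p ≠ 0 ∧ ‖p‖ < 13 / 10 * a₀}) : EuclideanSpace ℝ (Fin 3))) ≤ τ)) ∧
      ∀ p ∈ P.points, dist p q ≤ R → IsTwoShellGoodSet (1 / 20) (47 / 50) 1 P.points p) with hIB
  set Sp := (P.motif.filter fun q =>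
      ∃ p ∈ P.points, dist p q ≤ R ∧ ¬ IsTwoShellGoodSet (1 / 20) (47 / 50) 1 P.points p) with hSp
  set G := (P.motif.filter fun q => ¬ IsTwoShellGoodSet (1 / 20) (47 / 50) 1 P.points q) with hG
  set M := (P.motif.filter fun q => ¬ (∃ A : EuclideanSpace ℝ (Fin 3) →ₗᵢ[ℝ] EuclideanSpace ℝ (Fin 3),
                   (∃ e : ↥{z : EuclideanSpace ℝ (Fin 3) | z ∈ P.points ∧ z ≠ q ∧ dist z (q) < 13 / 10 * a₀} ≃
                       ↥{p : EuclideanSpace ℝ (Fin 3) | p ∈ hcpStacking a₀ h₀ ∧ p ≠ 0 ∧ ‖p‖ < 13 / 10 * a₀},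
                     ∀ t : ↥{z : EuclideanSpace ℝ (Fin 3) | z ∈ P.points ∧ z ≠ q ∧ dist z (q) < 13 / 10 * a₀},
                       dist ((t : EuclideanSpace ℝ (Fin 3)) - q)
                         (A ((e t : ↥{p : EuclideanSpace ℝ (Fin 3) | p ∈ hcpStacking a₀ h₀ ∧ p ≠ 0 ∧ ‖p‖ < 13 / 10 * a₀}) : EuclideanSpace ℝ (Fin 3))) ≤ τ) ∨
                   (∃ e : ↥{z : EuclideanSpace ℝ (Fin 3) | z ∈ P.points ∧ z ≠ q ∧ dist z (q) < 13 / 10 * a₀} ≃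
                       ↥{p : EuclideanSpace ℝ (Fin 3) | p ∈ fccStacking a₀ h₀ ∧ p ≠ 0 ∧ ‖p‖ < 13 / 10 * a₀},
                     ∀ t : ↥{z : EuclideanSpace ℝ (Fin 3) | z ∈ P.points ∧ z ≠ q ∧ dist z (q) < 13 / 10 * a₀},
                       dist ((t : EuclideanSpace ℝ (Fin 3)) - q)
                         (A ((e t : ↥{p : EuclideanSpace ℝ (Fin 3) | p ∈ fccStacking a₀ h₀ ∧ p ≠ 0 ∧ ‖p‖ < 13 / 10 * a₀}) : EuclideanSpace ℝ (Fin 3))) ≤ τ)) ∧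
      IsTwoShellGoodSet (1 / 20) (47 / 50) 1 P.points q) with hM
  -- a mild site is interior-bad or spoiled
  have hsub : M ⊆ IB ∪ Sp := by
    intro q hq
    rw [hM, Finset.mem_filter] at hq
    rw [Finset.mem_union, hIB, hSp, Finset.mem_filter, Finset.mem_filter]
    by_cases hsp : ∃ p ∈ P.points, dist p q ≤ R ∧ ¬ IsTwoShellGoodSet (1 / 20) (47 / 50) 1 P.points p
    · exact Or.inr ⟨hq.1, hsp⟩
    · refine Or.inl ⟨hq.1, hq.2.1, ?_⟩
      intro p hp hpq
      by_contra hbad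
      exact hsp ⟨p, hp, hpq, hbad⟩
  have hcardM : (M.card : ℝ) ≤ (IB.card : ℝ) + (Sp.card : ℝ) := by
    have := (Finset.card_le_card hsub).trans (Finset.card_union_le IB Sp)
    exact_mod_cast this
  have hIB0 : (0 : ℝ) ≤ IB.card := by positivity
  have hSp0 : (0 : ℝ) ≤ Sp.card := by positivity
  have hG0 : (0 : ℝ) ≤ G.card := by positivity
  have hm0 : (0 : ℝ) ≤ P.motif.card := by positivity
  have hmin1 : min c 1 ≤ 1 := min_le_right _ _
  have hminc : min c 1 ≤ c := min_le_left _ _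
  have hmin0 : 0 ≤ min c 1 := le_of_lt (lt_min hc one_pos)
  have e1 : min c 1 * (M.card : ℝ) ≤ min c 1 * ((IB.card : ℝ) + (Sp.card : ℝ)) :=
    mul_le_mul_of_nonneg_left hcardM hmin0
  have e2 : min c 1 * (IB.card : ℝ) ≤ c * (IB.card : ℝ) := mul_le_mul_of_nonneg_right hminc hIB0
  have e3 : min c 1 * (Sp.card : ℝ) ≤ 1 * (Sp.card : ℝ) := mul_le_mul_of_nonneg_right hmin1 hSp0
  have e4 : C * (Sp.card : ℝ) ≤ C * (K * (G.card : ℝ)) := mul_le_mul_of_nonneg_left hSK hC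
  nlinarith [e1, e2, e3, e4, hL, hSK, hK, hC, hG0]

/-- **Interior ledger at box minimisers ⇒ `HcpRelativeLedger`**: instantiate at the LANDED box minimiser
(`stub_boxMinimiser`; enclosure `stub_boxMinimiserRigid` at `0.97129 ± 10⁻⁴` ⇒ `47/50 ≤ a ≤ 1`) and use the
landed packing lemma `SummedShellPricingSpoiledByGross.stub_spoiledByGross` (p172384). [folklore] -/
theorem hcpRelativeLedger_of_interiorLedgerAt
    (h :
    ∀ (a h : ℝ) (ha : a ≠ 0) (hh : h ≠ 0), (9 / 10 < a ∧ a < 1 ∧ |h - a * Real.sqrt (2 / 3)| ≤ a / 100) →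
      (∀ a' h' : ℝ, ∀ ha' : a' ≠ 0, ∀ hh' : h' ≠ 0, (9 / 10 < a' ∧ a' < 1 ∧ |h' - a' * Real.sqrt (2 / 3)| ≤ a' / 100) →
        (hcpPeriodicConfiguration ha hh).energyPerParticle lennardJones ≤
          (hcpPeriodicConfiguration ha' hh').energyPerParticle lennardJones) →
      ∃ R : ℝ, 0 < R ∧ ∃ C : ℝ, 0 ≤ C ∧ ∀ τ : ℝ, 0 < τ → τ ≤ 1 → ∃ c : ℝ, 0 < c ∧
        ∀ P : PeriodicConfiguration 3, (∀ u ∈ P.points, ∀ v ∈ P.points, u ≠ v → (1 / 3 : ℝ) ≤ dist u v) →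
          c * ((P.motif.filter fun q => ¬ (∃ A : EuclideanSpace ℝ (Fin 3) →ₗᵢ[ℝ] EuclideanSpace ℝ (Fin 3),
                   (∃ e : ↥{z : EuclideanSpace ℝ (Fin 3) | z ∈ P.points ∧ z ≠ q ∧ dist z (q) < 13 / 10 * a} ≃
                       ↥{p : EuclideanSpace ℝ (Fin 3) | p ∈ hcpStacking a h ∧ p ≠ 0 ∧ ‖p‖ < 13 / 10 * a},
                     ∀ t : ↥{z : EuclideanSpace ℝ (Fin 3) | z ∈ P.points ∧ z ≠ q ∧ dist z (q) < 13 / 10 * a},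
                       dist ((t : EuclideanSpace ℝ (Fin 3)) - q)
                         (A ((e t : ↥{p : EuclideanSpace ℝ (Fin 3) | p ∈ hcpStacking a h ∧ p ≠ 0 ∧ ‖p‖ < 13 / 10 * a}) : EuclideanSpace ℝ (Fin 3))) ≤ τ) ∨
                   (∃ e : ↥{z : EuclideanSpace ℝ (Fin 3) | z ∈ P.points ∧ z ≠ q ∧ dist z (q) < 13 / 10 * a} ≃
                       ↥{p : EuclideanSpace ℝ (Fin 3) | p ∈ fccStacking a h ∧ p ≠ 0 ∧ ‖p‖ < 13 / 10 * a},
                     ∀ t : ↥{z : EuclideanSpace ℝ (Fin 3) | z ∈ P.points ∧ z ≠ q ∧ dist z (q) < 13 / 10 * a},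
                       dist ((t : EuclideanSpace ℝ (Fin 3)) - q)
                         (A ((e t : ↥{p : EuclideanSpace ℝ (Fin 3) | p ∈ fccStacking a h ∧ p ≠ 0 ∧ ‖p‖ < 13 / 10 * a}) : EuclideanSpace ℝ (Fin 3))) ≤ τ)) ∧
                ∀ p ∈ P.points, dist p q ≤ R → IsTwoShellGoodSet (1 / 20) (47 / 50) 1 P.points p).card : ℝ)
            - C * ((P.motif.filter fun q =>
                ∃ p ∈ P.points, dist p q ≤ R ∧ ¬ IsTwoShellGoodSet (1 / 20) (47 / 50) 1 P.points p).card : ℝ)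
          ≤ (P.motif.card : ℝ) *
              (P.energyPerParticle lennardJones - (hcpPeriodicConfiguration ha hh).energyPerParticle lennardJones)) :
    (∃ (a₀ h₀ : ℝ) (ha : a₀ ≠ 0) (hh : h₀ ≠ 0), 47 / 50 ≤ a₀ ∧ a₀ ≤ 1 ∧ |h₀ - a₀ * Real.sqrt (2 / 3)| ≤ a₀ / 100 ∧
    ∃ C : ℝ, 0 ≤ C ∧ ∀ τ : ℝ, 0 < τ → τ ≤ 1 → ∃ c : ℝ, 0 < c ∧
      ∀ P : PeriodicConfiguration 3, (∀ u ∈ P.points, ∀ v ∈ P.points, u ≠ v → (1 / 3 : ℝ) ≤ dist u v) →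
        c * ((P.motif.filter fun q => ¬ (∃ A : EuclideanSpace ℝ (Fin 3) →ₗᵢ[ℝ] EuclideanSpace ℝ (Fin 3),
                   (∃ e : ↥{z : EuclideanSpace ℝ (Fin 3) | z ∈ P.points ∧ z ≠ q ∧ dist z (q) < 13 / 10 * a₀} ≃
                       ↥{p : EuclideanSpace ℝ (Fin 3) | p ∈ hcpStacking a₀ h₀ ∧ p ≠ 0 ∧ ‖p‖ < 13 / 10 * a₀},
                     ∀ t : ↥{z : EuclideanSpace ℝ (Fin 3) | z ∈ P.points ∧ z ≠ q ∧ dist z (q) < 13 / 10 * a₀},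
                       dist ((t : EuclideanSpace ℝ (Fin 3)) - q)
                         (A ((e t : ↥{p : EuclideanSpace ℝ (Fin 3) | p ∈ hcpStacking a₀ h₀ ∧ p ≠ 0 ∧ ‖p‖ < 13 / 10 * a₀}) : EuclideanSpace ℝ (Fin 3))) ≤ τ) ∨
                   (∃ e : ↥{z : EuclideanSpace ℝ (Fin 3) | z ∈ P.points ∧ z ≠ q ∧ dist z (q) < 13 / 10 * a₀} ≃
                       ↥{p : EuclideanSpace ℝ (Fin 3) | p ∈ fccStacking a₀ h₀ ∧ p ≠ 0 ∧ ‖p‖ < 13 / 10 * a₀},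
                     ∀ t : ↥{z : EuclideanSpace ℝ (Fin 3) | z ∈ P.points ∧ z ≠ q ∧ dist z (q) < 13 / 10 * a₀},
                       dist ((t : EuclideanSpace ℝ (Fin 3)) - q)
                         (A ((e t : ↥{p : EuclideanSpace ℝ (Fin 3) | p ∈ fccStacking a₀ h₀ ∧ p ≠ 0 ∧ ‖p‖ < 13 / 10 * a₀}) : EuclideanSpace ℝ (Fin 3))) ≤ τ)) ∧
              IsTwoShellGoodSet (1 / 20) (47 / 50) 1 P.points q).card : ℝ)
          - C * ((P.motif.filter fun q => ¬ IsTwoShellGoodSet (1 / 20) (47 / 50) 1 P.points q).card : ℝ)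
        ≤ (P.motif.card : ℝ) *
            (P.energyPerParticle lennardJones - (hcpPeriodicConfiguration ha hh).energyPerParticle lennardJones)) := by
  refine hcpRelativeLedger_of_interiorLedger_of_packing ?_ SummedShellPricingSpoiledByGross.stub_spoiledByGross
  obtain ⟨a, h', ha, hh, hbox, hmin⟩ := HcpLandscapeGapBirth.stub_boxMinimiser
  obtain ⟨⟨hea, -⟩, -⟩ := HcpLandscapeGapBirth.stub_boxMinimiserRigid a h' ha hh hbox hmin
  obtain ⟨R, hR, C, hC, H⟩ := h a h' ha hh hbox hmin
  refine ⟨a, h', ha, hh, ?_, hbox.2.1.le, hbox.2.2, R, hR, C, hC, H⟩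
  have := (abs_le.1 hea).1
  linarith

/-- **The calibration reduction of K1**: the hub crux `CoerciveTwoShellGap` (stmt-13956) and the calibrated
site inequality at the box minimiser (CSI, registered stub `stub_calibratedSiteInequality` of line `Sketch`)
imply `SummedShellPricing` — via `hcpRelativeLedger_of_interiorLedgerAt` and the landed split glue
`SummedShellPricingSplit.SummedShellPricing_of_subs` (p169653). [folklore] -/
theorem summedShellPricing_of_coerciveTwoShellGap_of_calibratedSiteInequality
    (h1 : Summit.AtomisticToContinuum.Crystallization.Theses.PhononSlackCertificates.CoerciveTwoShellGap)
    (h2 :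
    ∀ (a h : ℝ) (ha : a ≠ 0) (hh : h ≠ 0), (9 / 10 < a ∧ a < 1 ∧ |h - a * Real.sqrt (2 / 3)| ≤ a / 100) →
      (∀ a' h' : ℝ, ∀ ha' : a' ≠ 0, ∀ hh' : h' ≠ 0, (9 / 10 < a' ∧ a' < 1 ∧ |h' - a' * Real.sqrt (2 / 3)| ≤ a' / 100) →
        (hcpPeriodicConfiguration ha hh).energyPerParticle lennardJones ≤
          (hcpPeriodicConfiguration ha' hh').energyPerParticle lennardJones) →
      ∃ R : ℝ, 0 < R ∧ ∃ G : ℝ, 0 ≤ G ∧ ∀ τ : ℝ, 0 < τ → τ ≤ 1 → ∃ κ : ℝ, 0 < κ ∧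
        ∀ S : Set (EuclideanSpace ℝ (Fin 3)), (∀ u ∈ S, ∀ v ∈ S, u ≠ v → (1 / 3 : ℝ) ≤ dist u v) →
          ∃ g : EuclideanSpace ℝ (Fin 3) → EuclideanSpace ℝ (Fin 3) → ℝ,
            (∀ y z, g y z = -g z y) ∧
            (∀ y z, |g y z| ≤ G * (dist y z)⁻¹ ^ 6) ∧
            (∀ v : EuclideanSpace ℝ (Fin 3), (∀ p, p + v ∈ S ↔ p ∈ S) → ∀ y z, g (y + v) (z + v) = g y z) ∧
            (∀ y ∈ S, (∀ p ∈ S, dist p y ≤ R → IsTwoShellGoodSet (1 / 20) (47 / 50) 1 S p) →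
                (hcpPeriodicConfiguration ha hh).energyPerParticle lennardJones
                  ≤ 1 / 2 * (∑' z : {z // z ∈ S ∧ z ≠ y}, lennardJones (dist y z.1))
                      + ∑' z : {z // z ∈ S ∧ z ≠ y}, g y z.1) ∧
            (∀ y ∈ S, (∀ p ∈ S, dist p y ≤ R → IsTwoShellGoodSet (1 / 20) (47 / 50) 1 S p) →
                ¬ (∃ A : EuclideanSpace ℝ (Fin 3) →ₗᵢ[ℝ] EuclideanSpace ℝ (Fin 3),
                   (∃ e : ↥{z : EuclideanSpace ℝ (Fin 3) | z ∈ S ∧ z ≠ y ∧ dist z (y) < 13 / 10 * a} ≃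
                       ↥{p : EuclideanSpace ℝ (Fin 3) | p ∈ hcpStacking a h ∧ p ≠ 0 ∧ ‖p‖ < 13 / 10 * a},
                     ∀ t : ↥{z : EuclideanSpace ℝ (Fin 3) | z ∈ S ∧ z ≠ y ∧ dist z (y) < 13 / 10 * a},
                       dist ((t : EuclideanSpace ℝ (Fin 3)) - y)
                         (A ((e t : ↥{p : EuclideanSpace ℝ (Fin 3) | p ∈ hcpStacking a h ∧ p ≠ 0 ∧ ‖p‖ < 13 / 10 * a}) : EuclideanSpace ℝ (Fin 3))) ≤ τ) ∨
                   (∃ e : ↥{z : EuclideanSpace ℝ (Fin 3) | z ∈ S ∧ z ≠ y ∧ dist z (y) < 13 / 10 * a} ≃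
                       ↥{p : EuclideanSpace ℝ (Fin 3) | p ∈ fccStacking a h ∧ p ≠ 0 ∧ ‖p‖ < 13 / 10 * a},
                     ∀ t : ↥{z : EuclideanSpace ℝ (Fin 3) | z ∈ S ∧ z ≠ y ∧ dist z (y) < 13 / 10 * a},
                       dist ((t : EuclideanSpace ℝ (Fin 3)) - y)
                         (A ((e t : ↥{p : EuclideanSpace ℝ (Fin 3) | p ∈ fccStacking a h ∧ p ≠ 0 ∧ ‖p‖ < 13 / 10 * a}) : EuclideanSpace ℝ (Fin 3))) ≤ τ)) →
                (hcpPeriodicConfiguration ha hh).energyPerParticle lennardJones + κ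
                  ≤ 1 / 2 * (∑' z : {z // z ∈ S ∧ z ≠ y}, lennardJones (dist y z.1))
                      + ∑' z : {z // z ∈ S ∧ z ≠ y}, g y z.1)) :
    Summit.AtomisticToContinuum.Crystallization.Theses.SpectralChargeLedger.SummedShellPricing :=
  SummedShellPricingSplit.SummedShellPricing_of_subs h1
    (hcpRelativeLedger_of_interiorLedgerAt (interiorLedgerAt_of_calibratedSiteInequality h2))

end Summit.AtomisticToContinuum.Crystallization.Theorems.SummedShellPricingCalibration

end
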